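import Summits.ResolutionOfSingularities.ResolutionOfSingularities.Theorems.FrobeniusClosingPatchingRelPerfectCoreRungReductions
import Literature.AlgebraicGeometry.Resolution.BlowupsProduct
import HarnessLib

/-!
# Crux `PatchingRelPerfect` (stmt-ResolutionOfSingularities-16161), chain w52 — CORE RUNG r1d:
# closure properties of the COMPANION CLASS (reductions, principal multiples, powers,
# sup-reductions)

[OURS · L1 W5.2 · rung] The open core of skeleton v5.1 (`stub_atomDimFourBlowup`, blow-up form
`AtomDimFourBlowupAt p`) follows, for a blowing up `T = Bl_I Spec S`, from a **companion** of `I`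
(W2, `atomConclusion_of_companion`, p460515): an `𝔪`-primary ideal `Q` such that some blowing up
of `Spec S` along `I · Q` is regular.  Write `𝒞(S)` for the class of ideals `I` of the regular
local ring `S` admitting such a `Q` — the COMPANION CLASS; the companion form of the open core
(certificate `patchingRelPerfect_of_printed_of_companions_of_dimGeFive`, p462937) says that every
non-zero `I` of a complete regular local `κ[[x₁,…,x₄]]`, `κ` perfect, whose blowing up is regular
off `V(𝔪)` lies in `𝒞`.  Rungs r0 (p465206), r1a (`…CoreRungReductions`, reductions of powers
of `𝔪`) and r1c (`𝔪² + (z)`, in progress) put explicit families into `𝒞`.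

This file proves, in EVERY dimension and over EVERY regular local base, that `𝒞` is closed under
the elementary operations of the theory of complete ideals, so that each explicit family landed
by a rung drags its reductions, principal multiples and powers along:

* `companion_of_reduction` — **reductions**: if `K ∈ 𝒞` is `𝔪`-primary (`𝔪ᵐ ⊆ K`) and
  `I · Kʳ = Kʳ⁺¹`, then `I ∈ 𝒞` with companion `Kʳ · Q_K`.  (Stacks 080A: on the regular model
  `B = Bl_{K Q} Spec S` the ideal `K𝒪_B` is invertible — a factor of the invertible `(KQ)𝒪_B`,
  Tag 07ZV — so `B` is also the blowing up along `K Q · Kʳ = I · (Kʳ Q)`.)  This strictly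
  extends r1a's `atomConclusion_of_mul_eq_of_forall_isRegular`, where `K` itself had to have
  regular blowing ups (`Q_K = S`);
* `companion_span_singleton_mul` — **principal multiples** `(a) · I`, `a ≠ 0` (same companion);
* `companion_pow` — **powers** `Iᵏ`, `k ≥ 1` (companion `Qᵏ`);
* `sup_mul_pow_eq_pow_of_reduction` — **sup-reductions** (pure ideal arithmetic): if
  `N₀ ⊆ N` and `N₀ · Nʳ = Nʳ⁺¹` then `(𝔞 + N₀) · (𝔞 + N)ʳ = (𝔞 + N)ʳ⁺¹` for every ideal `𝔞`;
  with `companion_of_reduction` this puts `𝔞 + N₀` into `𝒞` whenever `𝔞 + N ∈ 𝒞` is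
  `𝔪`-primary (`companion_sup_of_reduction`);
* `atomConclusion_of_companion'` — `I ∈ 𝒞`, `I ≠ 0` ⇒ the core's conclusion for every blowing up
  of `Spec S` along `I` (universe-polymorphic form of W2's `w2_companionKernel`), and
  `companion_of_forall_isRegular` — ideals with regular blowing ups lie in `𝒞` (`Q = S`).

PAYOFF (separate corollary file, once r1c lands): every monomial complete intersection
`(z₁, …, z_m, y₁², …, y_{n-m}²)` is the sup-reduction `𝔞 + N₀` of `𝔞 + (y)² = 𝔞 + 𝔪²`
(`𝔞 = (z)`, `N₀ = (yⱼ²)` a reduction of `N = (y)²` by r1a's pigeonhole), hence in `𝒞`.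
HONEST SCOPE: structure of the companion statement only; no new stratum of the core is settled
here by itself.  The class `𝒞` is written UNFOLDED (no new definition).  Nothing here is a
statement of the manuscript under review.

## References

* The Stacks Project, Tags 080A, 080B, 07ZV, 0809. [StacksProject]
* I. Swanson, C. Huneke, *Integral Closure of Ideals, Rings, and Modules*, LMS LN 336 (2006),
  Def. 1.2.1, Prop. 8.1.5 (reductions; only the defining identity `I Kʳ = Kʳ⁺¹` is used here).
  [folklore]
-/

-- `Summit.<Summit>.<Sub>.Theorems` with `Sub = Summit` (single-conjunct summit, D-0017)
set_option linter.dupNamespace false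

noncomputable section

open CategoryTheory CategoryTheory.Limits AlgebraicGeometry Literature.AlgebraicGeometry.Resolution

namespace Summit.ResolutionOfSingularities.ResolutionOfSingularities.Theorems

universe u

namespace CoreRungClosure

/-! ## Ideal arithmetic: sup-reductions -/

/-- **Sup-reductions.** In a commutative semiring of ideals: if `N₀ ≤ N` and `N₀ · Nʳ = Nʳ⁺¹`
(`N₀` is a reduction of `N`), then for every ideal `𝔞`, `(𝔞 + N₀) · (𝔞 + N)ʳ = (𝔞 + N)ʳ⁺¹`
(`𝔞 + N₀` is a reduction of `𝔞 + N` with the same exponent).  Proof without binomial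
expansion: by descending induction, `Nʲ (𝔞 + N)ⁱ ⊆ (𝔞 + N₀)(𝔞 + N)ʳ` whenever `i + j = r + 1`.
[folklore] -/
theorem sup_mul_pow_eq_pow_of_reduction {S : Type u} [CommSemiring S] {N₀ N : Ideal S}
    (hle : N₀ ≤ N) {r : ℕ} (hred : N₀ * N ^ r = N ^ (r + 1)) (𝔞 : Ideal S) :
    (𝔞 ⊔ N₀) * (𝔞 ⊔ N) ^ r = (𝔞 ⊔ N) ^ (r + 1) := by
  apply le_antisymm
  · rw [pow_succ']
    exact Ideal.mul_mono_left (sup_le_sup_left hle 𝔞)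
  · -- descending induction: `N ^ (r + 1 - i) * (𝔞 ⊔ N) ^ i ≤ (𝔞 ⊔ N₀) * (𝔞 ⊔ N) ^ r`
    have key : ∀ i : ℕ, i ≤ r + 1 →
        N ^ (r + 1 - i) * (𝔞 ⊔ N) ^ i ≤ (𝔞 ⊔ N₀) * (𝔞 ⊔ N) ^ r := by
      intro i
      induction i with
      | zero =>
        intro _
        rw [Nat.sub_zero, pow_zero, mul_one, ← hred]
        exact Ideal.mul_mono le_sup_right (Ideal.pow_right_mono le_sup_right r)
      | succ i ih =>
        intro hi
        have hi' : i ≤ r + 1 := Nat.le_of_succ_le hi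
        have hir : i ≤ r := by omega
        have e1 : r + 1 - (i + 1) = r - i := by omega
        have hsub : r - i + 1 = r + 1 - i := by omega
        -- `N^(r-i) (𝔞+N)^(i+1) = N^(r-i) (𝔞+N)^i 𝔞 + N^(r-i) (𝔞+N)^i N`
        rw [e1, pow_succ, ← mul_assoc, Ideal.mul_sup]
        refine sup_le ?_ ?_
        · -- the `𝔞`-part
          have h1 : N ^ (r - i) * (𝔞 ⊔ N) ^ i ≤ (𝔞 ⊔ N) ^ r := by
            calc N ^ (r - i) * (𝔞 ⊔ N) ^ i ≤ (𝔞 ⊔ N) ^ (r - i) * (𝔞 ⊔ N) ^ i :=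
                  Ideal.mul_mono_left (Ideal.pow_right_mono le_sup_right _)
              _ = (𝔞 ⊔ N) ^ r := by rw [← pow_add, Nat.sub_add_cancel hir]
          calc N ^ (r - i) * (𝔞 ⊔ N) ^ i * 𝔞 = 𝔞 * (N ^ (r - i) * (𝔞 ⊔ N) ^ i) :=
                mul_comm _ _
            _ ≤ (𝔞 ⊔ N₀) * (𝔞 ⊔ N) ^ r := Ideal.mul_mono le_sup_left h1
        · -- the `N`-part: induction hypothesis
          have e2 : N ^ (r - i) * (𝔞 ⊔ N) ^ i * N = N ^ (r + 1 - i) * (𝔞 ⊔ N) ^ i := by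
            rw [mul_comm _ N, ← mul_assoc, ← pow_succ', hsub]
          rw [e2]
          exact ih hi'
    have h := key (r + 1) le_rfl
    rwa [Nat.sub_self, pow_zero, one_mul] at h

/-! ## Blow-up bookkeeping -/

/-- The blowing up of an ideal `K` of a ring is a blowing up of every power `Kᵈ`, `d ≥ 1`
(Stacks 080A with the invertible `K𝒪` upstairs).  Generalises r0's `isBlowup_pow_maximalIdeal`.
[cite: StacksProject, Tag 080A] -/
theorem isBlowup_idealSheaf_pow {S : Type u} [CommRing S] {B : Scheme.{u}} {π : B ⟶ Spec (.of S)}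
    {K : Ideal S} (hπ : IsBlowup π (affineBlowup.idealSheaf K)) (d : ℕ) (hd : 0 < d) :
    IsBlowup π (affineBlowup.idealSheaf (K ^ d)) := by
  induction d with
  | zero => exact absurd hd (lt_irrefl 0)
  | succ d ih =>
    rcases Nat.eq_zero_or_pos d with h0 | hpos
    · subst h0
      simpa using hπ
    · have h1 := ih hpos
      have h2 : IsBlowup (𝟙 B) ((affineBlowup.idealSheaf K).comap π) :=
        IsBlowup.id hπ.isEffectiveCartier
      have h3 := h1.comp h2
      rw [Category.id_comp, ← affineBlowup.idealSheaf_mul, ← pow_succ] at h3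
      exact h3

/-- Pulling back along a morphism `b`, the ideal sheaf of a power `Kʳ` is an effective Cartier
divisor as soon as that of `K` is (products of effective Cartier divisors, Stacks 01WU; `K⁰ = S`
pulls back to the unit ideal). [cite: StacksProject, Tag 01WU] -/
theorem isEffectiveCartier_comap_idealSheaf_pow {S : Type u} [CommRing S] {B : Scheme.{u}}
    (b : B ⟶ Spec (.of S)) {K : Ideal S}
    (hK : IsEffectiveCartier ((affineBlowup.idealSheaf K).comap b)) (r : ℕ) :
    IsEffectiveCartier ((affineBlowup.idealSheaf (K ^ r)).comap b) := by
  induction r with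
  | zero =>
    rw [pow_zero, Ideal.one_eq_top, affineBlowup.idealSheaf_top,
      Scheme.IdealSheafData.comap_top]
    exact isEffectiveCartier_top
  | succ r ih =>
    rw [pow_succ, affineBlowup.idealSheaf_mul, comap_mul]
    exact ih.mul hK

/-- An `𝔪`-primary ideal `K ⊇ 𝔪ᵐ` of a reduced local ring with non-zero maximal ideal is
non-zero. [folklore] -/
theorem ne_bot_of_pow_maximalIdeal_le {S : Type u} [CommRing S] [IsLocalRing S] [IsReduced S]
    (hm : IsLocalRing.maximalIdeal S ≠ ⊥) {K : Ideal S} {m : ℕ}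
    (hKm : IsLocalRing.maximalIdeal S ^ m ≤ K) : K ≠ ⊥ := by
  intro hK
  rw [hK, le_bot_iff] at hKm
  rcases Nat.eq_zero_or_pos m with h0 | hpos
  · subst h0
    rw [pow_zero, Ideal.one_eq_top] at hKm
    exact top_ne_bot hKm
  · exact hm ((Ideal.pow_eq_bot (pos_iff_ne_zero.mp hpos)).mp hKm)

end CoreRungClosure

open CoreRungClosure

/-! ## The companion class `𝒞`, unfolded: `∃ Q m, 𝔪ᵐ ≤ Q ∧ ∃ B b, IsBlowup b (I·Q)~ ∧ B regular` -/

/-- **`𝒞 ⇒` the core's conclusion** (W2, universe-polymorphic form of `w2_companionKernel`): if a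
non-zero ideal `I` of a regular local ring has an `𝔪`-primary companion `Q ⊇ 𝔪ᵐ` with a regular
blowing up of `Spec S` along `I · Q`, then every blowing up `f : T ⟶ Spec S` along `I` carries a
non-zero ideal sheaf `J` cosupported in the closed fibre with regular blowing up (`J = Q𝒪_T`).
The degenerate base (`𝔪 = 0`, so possibly `Q = 0`) is r1a's `coreRung_of_maximalIdeal_eq_bot`.
[cite: StacksProject, Tag 080A] -/
theorem atomConclusion_of_companion' {S : Type u} [CommRing S] [IsRegularLocalRing S]
    {I : Ideal S} (hI : I ≠ ⊥)
    (hC : ∃ (Q : Ideal S) (m : ℕ), IsLocalRing.maximalIdeal S ^ m ≤ Q ∧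
      ∃ (B : Scheme.{u}) (b : B ⟶ Spec (.of S)),
        IsBlowup b (affineBlowup.idealSheaf (I * Q)) ∧ Scheme.IsRegular B)
    (T : Scheme.{u}) (f : T ⟶ Spec (.of S)) (hf : IsBlowup f (affineBlowup.idealSheaf I)) :
    ∃ (J : T.IdealSheafData) (T' : Scheme.{u}) (π : T' ⟶ T), J ≠ ⊥ ∧
      (∀ t : T, t ∈ J.support → f.base t = IsLocalRing.closedPoint S) ∧
      IsBlowup π J ∧ Scheme.IsRegular T' := by
  by_cases hm : IsLocalRing.maximalIdeal S = ⊥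
  · exact coreRung_of_maximalIdeal_eq_bot hm hI T f hf
  · haveI : IsDomain S := isDomain_of_isRegularLocalRing S
    obtain ⟨Q, m, hQm, B, b, hb, hB⟩ := hC
    have hQ : Q ≠ ⊥ := ne_bot_of_pow_maximalIdeal_le hm hQm
    rw [affineBlowup.idealSheaf_mul] at hb
    exact atomConclusion_of_companion_regularLocal hf (affineBlowup.idealSheaf_ne_bot hI)
      (affineBlowup.idealSheaf_ne_bot hQ) (support_idealSheaf_subset_closedPoint hQm) hb hB

/-- **Ideals with regular blowing ups lie in `𝒞`** (companion `Q = S`, `m = 0`). [folklore] -/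
theorem companion_of_forall_isRegular {S : Type u} [CommRing S] [IsLocalRing S] {K : Ideal S}
    (hK : ∀ (B : Scheme.{u}) (b : B ⟶ Spec (.of S)),
      IsBlowup b (affineBlowup.idealSheaf K) → Scheme.IsRegular B) :
    ∃ (Q : Ideal S) (m : ℕ), IsLocalRing.maximalIdeal S ^ m ≤ Q ∧
      ∃ (B : Scheme.{u}) (b : B ⟶ Spec (.of S)),
        IsBlowup b (affineBlowup.idealSheaf (K * Q)) ∧ Scheme.IsRegular B := by
  obtain ⟨B, b, hb⟩ := exists_isBlowup (Spec (.of S)) (affineBlowup.idealSheaf K)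
  refine ⟨⊤, 0, by rw [pow_zero, Ideal.one_eq_top], B, b, ?_, hK B b hb⟩
  rwa [Ideal.mul_top]

/-- **`𝒞` is closed under reductions.** Let `S` be regular local, `K ⊇ 𝔪ᵐ` an `𝔪`-primary ideal
in the companion class (some `𝔪`-primary `Q ⊇ 𝔪ᵐ'` has a regular blowing up
`B = Bl_{K·Q} Spec S`), and `I · Kʳ = Kʳ⁺¹`.  Then `I` is in the companion class, with companion
`Kʳ · Q ⊇ 𝔪^{m r + m'}` and the SAME regular model `B`: the ideal `K𝒪_B` is invertible (a factor
of the invertible `(K Q)𝒪_B`, Stacks 07ZV), hence so is `Kʳ𝒪_B`, so `B → Spec S` is also the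
blowing up along `K Q · Kʳ = I · (Kʳ Q)` (Stacks 080A / 080B twisting).
[cite: StacksProject, Tag 080A] [cite: StacksProject, Tag 07ZV] -/
theorem companion_of_reduction {S : Type u} [CommRing S] [IsLocalRing S] {I K : Ideal S}
    {m : ℕ} (hKm : IsLocalRing.maximalIdeal S ^ m ≤ K) {r : ℕ} (hIK : I * K ^ r = K ^ (r + 1))
    (hC : ∃ (Q : Ideal S) (m' : ℕ), IsLocalRing.maximalIdeal S ^ m' ≤ Q ∧
      ∃ (B : Scheme.{u}) (b : B ⟶ Spec (.of S)),
        IsBlowup b (affineBlowup.idealSheaf (K * Q)) ∧ Scheme.IsRegular B) :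
    ∃ (Q : Ideal S) (m' : ℕ), IsLocalRing.maximalIdeal S ^ m' ≤ Q ∧
      ∃ (B : Scheme.{u}) (b : B ⟶ Spec (.of S)),
        IsBlowup b (affineBlowup.idealSheaf (I * Q)) ∧ Scheme.IsRegular B := by
  obtain ⟨Q, m', hQm, B, b, hb, hB⟩ := hC
  refine ⟨K ^ r * Q, m * r + m', ?_, B, b, ?_, hB⟩
  · rw [pow_add, pow_mul]
    exact Ideal.mul_mono (Ideal.pow_right_mono hKm r) hQm
  · -- `K𝒪_B` is invertible, hence `Kʳ𝒪_B`; twist the centre `K Q` by it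
    have hKcart : IsEffectiveCartier ((affineBlowup.idealSheaf K).comap b) := by
      have h := hb.isEffectiveCartier
      rw [affineBlowup.idealSheaf_mul, comap_mul] at h
      exact h.of_mul_left
    have hKr : IsEffectiveCartier ((affineBlowup.idealSheaf (K ^ r)).comap b) :=
      isEffectiveCartier_comap_idealSheaf_pow b hKcart r
    have hcomp := hb.comp (IsBlowup.id hKr)
    rw [Category.id_comp, ← affineBlowup.idealSheaf_mul] at hcomp
    have hIKQ : I * (K ^ r * Q) = K * Q * K ^ r := by
      rw [← mul_assoc, hIK, pow_succ', mul_assoc, mul_comm (K ^ r) Q, ← mul_assoc]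
    rwa [hIKQ]

/-- **`𝒞` is closed under sup-reductions**: if `𝔞 + N ∈ 𝒞` is `𝔪`-primary and `N₀ ⊆ N` is a
reduction (`N₀ · Nʳ = Nʳ⁺¹`), then `𝔞 + N₀ ∈ 𝒞`, with companion `(𝔞 + N)ʳ · Q`.  The shape of the
monomial complete intersections `(z) + (yⱼ²)` inside `(z) + 𝔪²`. [cite: StacksProject, Tag 080A] -/
theorem companion_sup_of_reduction {S : Type u} [CommRing S] [IsLocalRing S] {𝔞 N₀ N : Ideal S}
    (hle : N₀ ≤ N) {r : ℕ} (hred : N₀ * N ^ r = N ^ (r + 1)) {m : ℕ}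
    (hKm : IsLocalRing.maximalIdeal S ^ m ≤ 𝔞 ⊔ N)
    (hC : ∃ (Q : Ideal S) (m' : ℕ), IsLocalRing.maximalIdeal S ^ m' ≤ Q ∧
      ∃ (B : Scheme.{u}) (b : B ⟶ Spec (.of S)),
        IsBlowup b (affineBlowup.idealSheaf ((𝔞 ⊔ N) * Q)) ∧ Scheme.IsRegular B) :
    ∃ (Q : Ideal S) (m' : ℕ), IsLocalRing.maximalIdeal S ^ m' ≤ Q ∧
      ∃ (B : Scheme.{u}) (b : B ⟶ Spec (.of S)),
        IsBlowup b (affineBlowup.idealSheaf ((𝔞 ⊔ N₀) * Q)) ∧ Scheme.IsRegular B :=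
  companion_of_reduction hKm (sup_mul_pow_eq_pow_of_reduction hle hred 𝔞) hC

/-- **`𝒞` is closed under non-zero principal multiples**: if `I ∈ 𝒞` with regular model
`B = Bl_{I·Q} Spec S` and `a` is a non-zero-divisor, then `(a) · I ∈ 𝒞` with the same companion
and the same model (`(a)~` is an effective Cartier divisor on `Spec S`; twisting the centre by it
does not change the blowing up, Stacks 080B). [cite: StacksProject, Tag 080B] -/
theorem companion_span_singleton_mul {S : Type u} [CommRing S] [IsLocalRing S] {I : Ideal S}
    {a : S} (ha : a ∈ nonZeroDivisors S)
    (hC : ∃ (Q : Ideal S) (m : ℕ), IsLocalRing.maximalIdeal S ^ m ≤ Q ∧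
      ∃ (B : Scheme.{u}) (b : B ⟶ Spec (.of S)),
        IsBlowup b (affineBlowup.idealSheaf (I * Q)) ∧ Scheme.IsRegular B) :
    ∃ (Q : Ideal S) (m : ℕ), IsLocalRing.maximalIdeal S ^ m ≤ Q ∧
      ∃ (B : Scheme.{u}) (b : B ⟶ Spec (.of S)),
        IsBlowup b (affineBlowup.idealSheaf (Ideal.span {a} * I * Q)) ∧ Scheme.IsRegular B := by
  obtain ⟨Q, m, hQm, B, b, hb, hB⟩ := hC
  refine ⟨Q, m, hQm, B, b, ?_, hB⟩
  have h := hb.mul_of_isEffectiveCartier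
    (affineBlowup.isEffectiveCartier_idealSheaf_span_singleton ha)
  rw [← affineBlowup.idealSheaf_mul] at h
  have heq : Ideal.span {a} * I * Q = I * Q * Ideal.span {a} := by
    rw [mul_comm (I * Q) (Ideal.span {a}), mul_assoc]
  rwa [heq]

/-- **`𝒞` is closed under powers**: if `I ∈ 𝒞` with companion `Q` then `Iᵏ ∈ 𝒞` (`k ≥ 1`) with
companion `Qᵏ` and the same regular model, a blowing up along `I Q` being one along `(I Q)ᵏ`.
[cite: StacksProject, Tag 080A] -/
theorem companion_pow {S : Type u} [CommRing S] [IsLocalRing S] {I : Ideal S} {k : ℕ}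
    (hk : 0 < k)
    (hC : ∃ (Q : Ideal S) (m : ℕ), IsLocalRing.maximalIdeal S ^ m ≤ Q ∧
      ∃ (B : Scheme.{u}) (b : B ⟶ Spec (.of S)),
        IsBlowup b (affineBlowup.idealSheaf (I * Q)) ∧ Scheme.IsRegular B) :
    ∃ (Q : Ideal S) (m : ℕ), IsLocalRing.maximalIdeal S ^ m ≤ Q ∧
      ∃ (B : Scheme.{u}) (b : B ⟶ Spec (.of S)),
        IsBlowup b (affineBlowup.idealSheaf (I ^ k * Q)) ∧ Scheme.IsRegular B := by
  obtain ⟨Q, m, hQm, B, b, hb, hB⟩ := hC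
  refine ⟨Q ^ k, m * k, ?_, B, b, ?_, hB⟩
  · rw [pow_mul]
    exact Ideal.pow_right_mono hQm k
  · rw [← mul_pow]
    exact isBlowup_idealSheaf_pow hb k hk

/-! ## The rungs in core format -/

/-- **CORE RUNG r1d — reductions of companioned ideals.** Let `S` be regular local, `K ⊇ 𝔪ᵐ` an
`𝔪`-primary ideal with an `𝔪`-primary companion `Q` (some `Bl_{K·Q} Spec S` regular), and
`I ≠ 0` with `I · Kʳ = Kʳ⁺¹`.  Then every blowing up `f : T ⟶ Spec S` along `I` satisfies the
conclusion of the blow-up-form open core `AtomDimFourBlowupAt` (companion `Kʳ Q`, `J = Kʳ Q𝒪_T`).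
Every dimension, every regular local base; no hypothesis of the manuscript under review.
[cite: StacksProject, Tag 080A] -/
theorem coreRung_reduction_of_companion {S : Type u} [CommRing S] [IsRegularLocalRing S]
    {I K : Ideal S} (hI : I ≠ ⊥) {m : ℕ} (hKm : IsLocalRing.maximalIdeal S ^ m ≤ K) {r : ℕ}
    (hIK : I * K ^ r = K ^ (r + 1))
    (hC : ∃ (Q : Ideal S) (m' : ℕ), IsLocalRing.maximalIdeal S ^ m' ≤ Q ∧
      ∃ (B : Scheme.{u}) (b : B ⟶ Spec (.of S)),
        IsBlowup b (affineBlowup.idealSheaf (K * Q)) ∧ Scheme.IsRegular B)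
    (T : Scheme.{u}) (f : T ⟶ Spec (.of S)) (hf : IsBlowup f (affineBlowup.idealSheaf I)) :
    ∃ (J : T.IdealSheafData) (T' : Scheme.{u}) (π : T' ⟶ T), J ≠ ⊥ ∧
      (∀ t : T, t ∈ J.support → f.base t = IsLocalRing.closedPoint S) ∧
      IsBlowup π J ∧ Scheme.IsRegular T' :=
  atomConclusion_of_companion' hI (companion_of_reduction hKm hIK hC) T f hf

/-- **CORE RUNG r1d — sup-reductions.** Let `S` be regular local, `𝔞 + N ⊇ 𝔪ᵐ` an `𝔪`-primary
ideal with an `𝔪`-primary companion, `N₀ ⊆ N` with `N₀ · Nʳ = Nʳ⁺¹`, and `𝔞 + N₀ ≠ 0`.  Then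
every blowing up of `Spec S` along `𝔞 + N₀` satisfies the conclusion of the blow-up-form open
core.  (Intended instance: `𝔞 = (z₁, …, z_m)` part of a regular system of parameters, `N = 𝔪²`
or `(y)²`, `N₀ = (y₁², …, y_{n-m}²)` — the monomial complete intersections with exponents in
`{1, 2}`, pending r1c for `𝔞 + 𝔪²`.) [cite: StacksProject, Tag 080A] -/
theorem coreRung_sup_reduction_of_companion {S : Type u} [CommRing S] [IsRegularLocalRing S]
    {𝔞 N₀ N : Ideal S} (hle : N₀ ≤ N) {r : ℕ} (hred : N₀ * N ^ r = N ^ (r + 1))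
    (hI : 𝔞 ⊔ N₀ ≠ ⊥) {m : ℕ} (hKm : IsLocalRing.maximalIdeal S ^ m ≤ 𝔞 ⊔ N)
    (hC : ∃ (Q : Ideal S) (m' : ℕ), IsLocalRing.maximalIdeal S ^ m' ≤ Q ∧
      ∃ (B : Scheme.{u}) (b : B ⟶ Spec (.of S)),
        IsBlowup b (affineBlowup.idealSheaf ((𝔞 ⊔ N) * Q)) ∧ Scheme.IsRegular B)
    (T : Scheme.{u}) (f : T ⟶ Spec (.of S))
    (hf : IsBlowup f (affineBlowup.idealSheaf (𝔞 ⊔ N₀))) :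
    ∃ (J : T.IdealSheafData) (T' : Scheme.{u}) (π : T' ⟶ T), J ≠ ⊥ ∧
      (∀ t : T, t ∈ J.support → f.base t = IsLocalRing.closedPoint S) ∧
      IsBlowup π J ∧ Scheme.IsRegular T' :=
  atomConclusion_of_companion' hI (companion_sup_of_reduction hle hred hKm hC) T f hf

/-- **CORE RUNG r1d — principal multiples.** For `S` regular local, `a ≠ 0` and `I ≠ 0` in the
companion class, every blowing up of `Spec S` along `(a) · I` satisfies the conclusion of the
blow-up-form open core (removing a common principal — e.g. monomial — factor costs nothing).
[cite: StacksProject, Tag 080B] -/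
theorem coreRung_span_singleton_mul_of_companion {S : Type u} [CommRing S]
    [IsRegularLocalRing S] {I : Ideal S} (hI : I ≠ ⊥) {a : S} (ha : a ≠ 0)
    (hC : ∃ (Q : Ideal S) (m : ℕ), IsLocalRing.maximalIdeal S ^ m ≤ Q ∧
      ∃ (B : Scheme.{u}) (b : B ⟶ Spec (.of S)),
        IsBlowup b (affineBlowup.idealSheaf (I * Q)) ∧ Scheme.IsRegular B)
    (T : Scheme.{u}) (f : T ⟶ Spec (.of S))
    (hf : IsBlowup f (affineBlowup.idealSheaf (Ideal.span {a} * I))) :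
    ∃ (J : T.IdealSheafData) (T' : Scheme.{u}) (π : T' ⟶ T), J ≠ ⊥ ∧
      (∀ t : T, t ∈ J.support → f.base t = IsLocalRing.closedPoint S) ∧
      IsBlowup π J ∧ Scheme.IsRegular T' := by
  haveI : IsDomain S := isDomain_of_isRegularLocalRing S
  have ha' : a ∈ nonZeroDivisors S := mem_nonZeroDivisors_of_ne_zero ha
  have hI' : Ideal.span {a} * I ≠ ⊥ := by
    intro h
    rcases Ideal.mul_eq_bot.mp h with h | h
    · exact ha (Ideal.span_singleton_eq_bot.mp h)
    · exact hI h
  obtain ⟨Q, m, hQm, B, b, hb, hB⟩ := companion_span_singleton_mul ha' hC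
  exact atomConclusion_of_companion' hI' ⟨Q, m, hQm, B, b, hb, hB⟩ T f hf

end Summit.ResolutionOfSingularities.ResolutionOfSingularities.Theorems

end
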